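import Mathlib
import HarnessLib

/-!
# Forster's argument, elementary half: the operator-norm lemma, the isotropic count, and
# general-position perturbations

Route `route-QuantumAdvantage-HankelLift`; infrastructure for the sign-rank rung of the open crux
`HankelLift.BeyondRectangles` (stmt-QuantumAdvantage-18440).  The rung
(`Theorems/HankelLiftBeyondRectanglesSignRank.lean`) is conditional on Forster's theorem
(`Literature.Computability.Complexity.ForsterHalfspaceBound`, J. Comput. System Sci. 65 (2002),
Thm 2.2).  This file PROVES the elementary half of Forster's proof, so that the named fact can be
reduced (in `…ForsterReduction.lean`) to its linear-algebra core, Forster's Theorem 4.1 (radial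
isotropic position):

* `sq_sum_transpose_le` — from the bilinear bound `|aᵀ M b| ≤ B‖a‖‖b‖`: `‖Mᵀ a‖² ≤ B²‖a‖²`.
* `forster_lemma21` — Forster's Lemma 2.1 in coordinates: for vectors `u_x` and unit vectors `v_y`
  realizing the sign pattern of a `±1` matrix `M` (`M_{xy}⟨u_x,v_y⟩ > 0`),
  `∑_y (∑_x |⟨u_x, v_y⟩|)² ≤ B² ∑_x ‖u_x‖²` (no positive-semidefiniteness needed: expand
  `‖∑_x M_{xy} u_x‖²` coordinatewise and use `sq_sum_transpose_le`).
* `forster_count` — if moreover the `u_x` are unit vectors in ISOTROPIC position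
  (`∑_x ⟨u_x,w⟩² = (|X|/k)‖w‖²`, `k` = dimension) then `|X|·|Y| ≤ B²·k²`
  (Forster's inequality (1): `∑_x |⟨u_x,v_y⟩| ≥ ∑_x ⟨u_x,v_y⟩² = |X|/k`).
* `exists_perturb_forall_notMem`, `exists_generalPosition` — any finite family of vectors in `ℝ^k`
  can be moved by at most `ε` in each coordinate into GENERAL POSITION (every subfamily of size
  `≤ k` linearly independent): one vector at a time, along a direction outside the finitely many
  spans to avoid (`Submodule.exists_forall_notMem_of_forall_ne_top`), at a step size avoiding the
  finitely many bad values.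
[cite: Forster2002, Lemma 2.1 and proof of Theorem 2.2]
-/

set_option linter.dupNamespace false -- D-0017: single-problem summit ⇒ `QuantumAdvantage.QuantumAdvantage` by design

noncomputable section

namespace Summit.QuantumAdvantage.QuantumAdvantage.Theorems.HankelLift.Forster

open Finset Real

/-! ## The operator-norm lemma and the count -/

/-- From the bilinear bound `|∑_{x,y} a_x M_{xy} b_y| ≤ B‖a‖₂‖b‖₂` (i.e. `‖M‖ ≤ B`):
`∑_y (∑_x a_x M_{xy})² ≤ B² ∑_x a_x²`, i.e. `‖Mᵀa‖ ≤ B‖a‖`. [folklore] -/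
theorem sq_sum_transpose_le {X Y : Type*} [Fintype X] [Fintype Y] (M : X → Y → ℝ) {B : ℝ}
    (hB : ∀ (a : X → ℝ) (b : Y → ℝ),
      |∑ x, ∑ y, a x * M x y * b y| ≤ B * Real.sqrt (∑ x, a x ^ 2) * Real.sqrt (∑ y, b y ^ 2))
    (a : X → ℝ) : ∑ y, (∑ x, a x * M x y) ^ 2 ≤ B ^ 2 * ∑ x, a x ^ 2 := by
  set c : Y → ℝ := fun y => ∑ x, a x * M x y with hc
  set S : ℝ := ∑ y, c y ^ 2 with hS
  set P : ℝ := ∑ x, a x ^ 2 with hP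
  have hS0 : 0 ≤ S := Finset.sum_nonneg fun y _ => sq_nonneg _
  have hP0 : 0 ≤ P := Finset.sum_nonneg fun x _ => sq_nonneg _
  have hSc : S = ∑ x, ∑ y, a x * M x y * c y := by
    rw [Finset.sum_comm]
    refine Finset.sum_congr rfl fun y _ => ?_
    rw [sq, hc]
    simp only
    rw [Finset.sum_mul]
  have h1 : S ≤ B * Real.sqrt P * Real.sqrt S := by
    have h := hB a c
    rw [← hSc] at h
    exact (le_abs_self S).trans h
  -- `S = √S · √S ≤ B √P √S` ⇒ `√S ≤ B √P` ⇒ `S ≤ B² P`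
  rcases eq_or_lt_of_le hS0 with hS00 | hSpos
  · rw [← hS00]; positivity
  · have hsq : Real.sqrt S * Real.sqrt S = S := Real.mul_self_sqrt hS0
    have hsqpos : 0 < Real.sqrt S := Real.sqrt_pos.mpr hSpos
    have h2 : Real.sqrt S ≤ B * Real.sqrt P := by
      have h3 : Real.sqrt S * Real.sqrt S ≤ (B * Real.sqrt P) * Real.sqrt S := by rw [hsq]; exact h1
      exact le_of_mul_le_mul_right h3 hsqpos
    calc S = Real.sqrt S ^ 2 := by rw [sq, hsq]
      _ ≤ (B * Real.sqrt P) ^ 2 := pow_le_pow_left₀ hsqpos.le h2 2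
      _ = B ^ 2 * P := by rw [mul_pow, Real.sq_sqrt hP0]

/-- **Forster's Lemma 2.1 (coordinate form).**  Let `M` be a `±1` matrix on `X × Y` with the
bilinear bound `B`, `u_x ∈ ℝ^ι` arbitrary and `v_y ∈ ℝ^ι` UNIT vectors with `M_{xy}·⟨u_x, v_y⟩ > 0`.
Then `∑_y (∑_x |⟨u_x, v_y⟩|)² ≤ B²·∑_x ‖u_x‖²`.  Proof: `∑_x |⟨u_x,v_y⟩| = ⟨∑_x M_{xy}u_x, v_y⟩ ≤
‖∑_x M_{xy} u_x‖`, and `∑_y ‖∑_x M_{xy}u_x‖² = ∑_l ‖Mᵀ u^{(l)}‖² ≤ B² ∑_l ‖u^{(l)}‖²`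
(`sq_sum_transpose_le` on each coordinate slice `u^{(l)} = (u_x(l))_x`).
[cite: Forster2002, Lemma 2.1] -/
theorem forster_lemma21 {X Y ι : Type*} [Fintype X] [Fintype Y] [Fintype ι] (M : X → Y → ℝ)
    (u : X → ι → ℝ) (v : Y → ι → ℝ) {B : ℝ}
    (hM : ∀ x y, M x y = 1 ∨ M x y = -1)
    (hsign : ∀ x y, 0 < M x y * ∑ l, u x l * v y l)
    (hB : ∀ (a : X → ℝ) (b : Y → ℝ),
      |∑ x, ∑ y, a x * M x y * b y| ≤ B * Real.sqrt (∑ x, a x ^ 2) * Real.sqrt (∑ y, b y ^ 2))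
    (hv : ∀ y, ∑ l, v y l ^ 2 = 1) :
    ∑ y, (∑ x, |∑ l, u x l * v y l|) ^ 2 ≤ B ^ 2 * ∑ x, ∑ l, u x l ^ 2 := by
  -- `∑_x |⟨u_x,v_y⟩| = ∑_l (∑_x M_{xy} u_x(l)) v_y(l)`
  have habs : ∀ x y, |∑ l, u x l * v y l| = M x y * ∑ l, u x l * v y l := by
    intro x y
    have hs := hsign x y
    rcases hM x y with h | h
    · rw [h, one_mul] at hs ⊢
      exact abs_of_pos hs
    · rw [h] at hs ⊢
      rw [abs_of_neg (by linarith), neg_one_mul]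
  have hrow : ∀ y, ∑ x, |∑ l, u x l * v y l| = ∑ l, (∑ x, M x y * u x l) * v y l := by
    intro y
    rw [Finset.sum_congr rfl fun x _ => habs x y]
    simp_rw [Finset.mul_sum, Finset.sum_mul]
    rw [Finset.sum_comm]
    exact Finset.sum_congr rfl fun l _ => Finset.sum_congr rfl fun x _ => by ring
  -- Cauchy–Schwarz in `l` with `‖v_y‖ = 1`
  have hcs : ∀ y, (∑ x, |∑ l, u x l * v y l|) ^ 2 ≤ ∑ l, (∑ x, M x y * u x l) ^ 2 := by
    intro y
    rw [hrow y]
    have h := Finset.sum_mul_sq_le_sq_mul_sq Finset.univ (fun l => ∑ x, M x y * u x l) (v y)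
    rw [hv y, mul_one] at h
    exact h
  -- sum over `y`, swap, and bound each coordinate slice
  calc ∑ y, (∑ x, |∑ l, u x l * v y l|) ^ 2
      ≤ ∑ y, ∑ l, (∑ x, M x y * u x l) ^ 2 := Finset.sum_le_sum fun y _ => hcs y
    _ = ∑ l, ∑ y, (∑ x, u x l * M x y) ^ 2 := by
        rw [Finset.sum_comm]
        exact Finset.sum_congr rfl fun l _ => Finset.sum_congr rfl fun y _ => by
          congr 1; exact Finset.sum_congr rfl fun x _ => mul_comm _ _
    _ ≤ ∑ l, B ^ 2 * ∑ x, u x l ^ 2 :=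
        Finset.sum_le_sum fun l _ => sq_sum_transpose_le M hB (fun x => u x l)
    _ = B ^ 2 * ∑ x, ∑ l, u x l ^ 2 := by rw [← Finset.mul_sum, Finset.sum_comm]

/-- **Forster's count** (the proof of his Theorem 2.2 after the reduction to isotropic position).
If `u_x, v_y ∈ ℝ^ι` are UNIT vectors realizing the `±1` matrix `M` (`M_{xy}⟨u_x,v_y⟩ > 0`), `M` has
the bilinear bound `B`, and the `u_x` are in isotropic position `∑_x ⟨u_x, w⟩² = (|X|/|ι|)‖w‖²`
for all `w`, then `|X|·|Y| ≤ B²·|ι|²`: for each `y`, `|X|/|ι| = ∑_x ⟨u_x,v_y⟩² ≤ ∑_x |⟨u_x,v_y⟩|`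
(as `|⟨u_x,v_y⟩| ≤ 1`), square, sum over `y`, and compare with `forster_lemma21`.
[cite: Forster2002, proof of Theorem 2.2] -/
theorem forster_count {X Y ι : Type*} [Fintype X] [Fintype Y] [Fintype ι] (M : X → Y → ℝ)
    (u : X → ι → ℝ) (v : Y → ι → ℝ) {B : ℝ}
    (hM : ∀ x y, M x y = 1 ∨ M x y = -1)
    (hsign : ∀ x y, 0 < M x y * ∑ l, u x l * v y l)
    (hB : ∀ (a : X → ℝ) (b : Y → ℝ),
      |∑ x, ∑ y, a x * M x y * b y| ≤ B * Real.sqrt (∑ x, a x ^ 2) * Real.sqrt (∑ y, b y ^ 2))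
    (hu : ∀ x, ∑ l, u x l ^ 2 = 1) (hv : ∀ y, ∑ l, v y l ^ 2 = 1)
    (hiso : ∀ w : ι → ℝ, ∑ x, (∑ l, u x l * w l) ^ 2 =
      (Fintype.card X : ℝ) / (Fintype.card ι : ℝ) * ∑ l, w l ^ 2) :
    (Fintype.card X : ℝ) * (Fintype.card Y : ℝ) ≤ B ^ 2 * (Fintype.card ι : ℝ) ^ 2 := by
  set nX : ℝ := (Fintype.card X : ℝ) with hnX
  set k : ℝ := (Fintype.card ι : ℝ) with hk
  -- inequality (1): `|X|/k ≤ ∑_x |⟨u_x, v_y⟩|`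
  have h1 : ∀ y, nX / k ≤ ∑ x, |∑ l, u x l * v y l| := by
    intro y
    have hsq : ∑ x, (∑ l, u x l * v y l) ^ 2 = nX / k := by rw [hiso (v y), hv y, mul_one]
    rw [← hsq]
    refine Finset.sum_le_sum fun x _ => ?_
    -- `t² ≤ |t|` for `|t| ≤ 1`
    have ht : (∑ l, u x l * v y l) ^ 2 ≤ 1 := by
      have h := Finset.sum_mul_sq_le_sq_mul_sq Finset.univ (u x) (v y)
      rw [hu x, hv y, mul_one] at h
      exact h
    have habs : |∑ l, u x l * v y l| ≤ 1 := by
      rw [← sq_le_one_iff_abs_le_one]; exact ht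
    calc (∑ l, u x l * v y l) ^ 2 = |∑ l, u x l * v y l| * |∑ l, u x l * v y l| := by
          rw [← sq_abs, sq]
      _ ≤ |∑ l, u x l * v y l| * 1 := mul_le_mul_of_nonneg_left habs (abs_nonneg _)
      _ = |∑ l, u x l * v y l| := mul_one _
  have h2 := forster_lemma21 M u v hM hsign hB hv
  have hsumu : ∑ x, ∑ l, u x l ^ 2 = nX := by
    rw [Finset.sum_congr rfl fun x _ => hu x, Finset.sum_const, Finset.card_univ, nsmul_eq_mul,
      mul_one]
  rw [hsumu] at h2
  -- sum the squares of (1) over `y`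
  have h3 : (Fintype.card Y : ℝ) * (nX / k) ^ 2 ≤ ∑ y, (∑ x, |∑ l, u x l * v y l|) ^ 2 := by
    calc (Fintype.card Y : ℝ) * (nX / k) ^ 2 = ∑ _y : Y, (nX / k) ^ 2 := by
          rw [Finset.sum_const, Finset.card_univ, nsmul_eq_mul]
      _ ≤ ∑ y, (∑ x, |∑ l, u x l * v y l|) ^ 2 :=
          Finset.sum_le_sum fun y _ => pow_le_pow_left₀ (by positivity) (h1 y) 2
  have h4 : (Fintype.card Y : ℝ) * (nX / k) ^ 2 ≤ B ^ 2 * nX := h3.trans h2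
  -- `|Y| nX²/k² ≤ B² nX` ⇒ `nX |Y| ≤ B² k²`
  rcases Nat.eq_zero_or_pos (Fintype.card X) with hX0 | hXpos
  · have : nX = 0 := by rw [hnX, hX0]; simp
    rw [this, zero_mul]; positivity
  rcases Nat.eq_zero_or_pos (Fintype.card ι) with hι0 | hιpos
  · -- `ι` empty: all inner products vanish, contradicting `hsign` (X, Y nonempty or not)
    rcases isEmpty_or_nonempty Y with hY | hY
    · have : (Fintype.card Y : ℝ) = 0 := by simp
      rw [this, mul_zero]; positivity
    · obtain ⟨y⟩ := hY
      obtain ⟨x⟩ := Fintype.card_pos_iff.mp hXpos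
      have hι : IsEmpty ι := Fintype.card_eq_zero_iff.mp hι0
      have := hsign x y
      simp at this
  have hkpos : 0 < k := by rw [hk]; exact_mod_cast hιpos
  have hnXpos : 0 < nX := by rw [hnX]; exact_mod_cast hXpos
  have h5 : (Fintype.card Y : ℝ) * nX ^ 2 ≤ B ^ 2 * nX * k ^ 2 := by
    have := mul_le_mul_of_nonneg_right h4 (sq_nonneg k)
    rwa [mul_assoc, ← mul_pow, div_mul_cancel₀ _ hkpos.ne'] at this
  nlinarith [h5, hnXpos]

/-! ## General position by small perturbations -/

/-- **Avoiding finitely many proper subspaces near a point.**  Given finitely many proper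
submodules `W_j` of `ℝ^k`, a point `z₀` and `ε > 0`, there is `z` with `|z_l − (z₀)_l| ≤ ε` for
all coordinates `l` and `z ∉ W_j` for all `j`: move from `z₀` along a direction `d ∉ ⋃ W_j`
(`Submodule.exists_forall_notMem_of_forall_ne_top`); for each `j` at most one step size is bad.
[folklore] -/
theorem exists_perturb_forall_notMem {k : ℕ} {J : Type*} [Finite J]
    (W : J → Submodule ℝ (Fin k → ℝ)) (hW : ∀ j, W j ≠ ⊤) (z₀ : Fin k → ℝ) {ε : ℝ} (hε : 0 < ε) :
    ∃ z : Fin k → ℝ, (∀ l, |z l - z₀ l| ≤ ε) ∧ ∀ j, z ∉ W j := by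
  classical
  obtain ⟨d, hd⟩ := Submodule.exists_forall_notMem_of_forall_ne_top W hW
  -- size of the direction
  set D : ℝ := ∑ l, |d l| with hD
  have hD0 : 0 ≤ D := Finset.sum_nonneg fun l _ => abs_nonneg _
  have hdl : ∀ l, |d l| ≤ D := fun l =>
    Finset.single_le_sum (f := fun l => |d l|) (fun l _ => abs_nonneg _) (Finset.mem_univ l)
  -- for each `j`, the set of bad step sizes is a subsingleton
  have hbad : ∀ j, ({s : ℝ | z₀ + s • d ∈ W j}).Subsingleton := by
    intro j s hs s' hs'
    by_contra hne
    apply hd j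
    have hsub : (s - s') • d ∈ W j := by
      have := (W j).sub_mem hs hs'
      rwa [add_sub_add_left_eq_sub, ← sub_smul] at this
    exact ((W j).smul_mem_iff (sub_ne_zero.mpr hne)).mp hsub
  have hfin : (⋃ j, {s : ℝ | z₀ + s • d ∈ W j}).Finite :=
    Set.finite_iUnion fun j => (hbad j).finite
  -- pick a good step size in `(0, ε/(D+1))`
  have hint : (Set.Ioo (0 : ℝ) (ε / (D + 1))).Infinite := Set.Ioo_infinite (by positivity)
  obtain ⟨s, hs, hsbad⟩ := (hint.sdiff hfin).nonempty
  rw [Set.mem_Ioo] at hs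
  refine ⟨z₀ + s • d, fun l => ?_, fun j hj => hsbad (Set.mem_iUnion.mpr ⟨j, hj⟩)⟩
  simp only [Pi.add_apply, Pi.smul_apply, smul_eq_mul, add_sub_cancel_left, abs_mul,
    abs_of_pos hs.1]
  calc s * |d l| ≤ ε / (D + 1) * D := mul_le_mul hs.2.le (hdl l) (abs_nonneg _) (by positivity)
    _ ≤ ε := by
        rw [div_mul_eq_mul_div, div_le_iff₀ (by positivity)]
        nlinarith

/-- **General position by an `ε`-perturbation.**  Every finite family `u : X → ℝ^k` can be moved
by at most `ε` in each coordinate to a family `u'` in GENERAL POSITION: `u'` is linearly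
independent on every set of at most `k` indices.  Induction on the set of indices already treated:
the next vector is re-chosen near its ORIGINAL value outside the spans of all sub-families of size
`< k` of the treated ones (`exists_perturb_forall_notMem`; those spans are proper, having dimension
`< k`), and `linearIndepOn_insert`. [folklore] -/
theorem exists_generalPosition {X : Type*} [Fintype X] [DecidableEq X] {k : ℕ}
    (u : X → Fin k → ℝ) {ε : ℝ} (hε : 0 < ε) :
    ∃ u' : X → Fin k → ℝ, (∀ x l, |u' x l - u x l| ≤ ε) ∧
      ∀ S : Finset X, S.card ≤ k → LinearIndepOn ℝ u' (S : Set X) := by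
  classical
  -- claim for the indices in `T`
  suffices h : ∀ T : Finset X, ∃ u' : X → Fin k → ℝ, (∀ x l, |u' x l - u x l| ≤ ε) ∧
      ∀ S : Finset X, S ⊆ T → S.card ≤ k → LinearIndepOn ℝ u' (S : Set X) by
    obtain ⟨u', hu', hli⟩ := h Finset.univ
    exact ⟨u', hu', fun S hS => hli S (Finset.subset_univ S) hS⟩
  intro T
  induction T using Finset.induction_on with
  | empty =>
    refine ⟨u, fun x l => by simp [hε.le], fun S hS _ => ?_⟩
    rw [Finset.subset_empty] at hS
    subst hS
    rw [Finset.coe_empty]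
    exact linearIndepOn_empty ℝ u
  | insert a T haT ih =>
    obtain ⟨u', hu', hli⟩ := ih
    -- the spans to avoid: sub-families of `T` of size `< k`
    let J := {S₀ : Finset X // S₀ ⊆ T ∧ S₀.card < k}
    let W : J → Submodule ℝ (Fin k → ℝ) := fun S₀ =>
      Submodule.span ℝ ((S₀.1.image u' : Finset (Fin k → ℝ)) : Set (Fin k → ℝ))
    have hW : ∀ j : J, W j ≠ ⊤ := by
      intro j htop
      have hdim : Module.finrank ℝ (W j) ≤ j.1.card :=
        (finrank_span_finset_le_card (R := ℝ) (j.1.image u')).trans Finset.card_image_le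
      have htop' : Module.finrank ℝ (W j) = k := by
        rw [htop, finrank_top, Module.finrank_fin_fun]
      rw [htop'] at hdim
      exact absurd j.2.2 (not_lt.mpr hdim)
    obtain ⟨z, hz, hzW⟩ := exists_perturb_forall_notMem W hW (u a) hε
    refine ⟨Function.update u' a z, fun x l => ?_, fun S hS hSk => ?_⟩
    · by_cases hxa : x = a
      · subst hxa; rw [Function.update_self]; exact hz l
      · rw [Function.update_of_ne hxa]; exact hu' x l
    · -- the updated family agrees with `u'` off `a`
      have heqOn : ∀ S₀ : Finset X, a ∉ S₀ →
          Set.EqOn u' (Function.update u' a z) (S₀ : Set X) := by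
        intro S₀ ha x hx
        rw [Function.update_of_ne]
        exact fun hxa => ha (hxa ▸ (Finset.mem_coe.mp hx))
      by_cases haS : a ∈ S
      · -- `S = insert a S₀`
        set S₀ := S.erase a with hS₀
        have hS₀T : S₀ ⊆ T := by
          intro x hx
          have hx' := Finset.mem_erase.mp hx
          exact (Finset.mem_insert.mp (hS hx'.2)).resolve_left hx'.1
        have hS₀k : S₀.card < k := by
          have hpos := Finset.card_pos.mpr ⟨a, haS⟩
          rw [hS₀, Finset.card_erase_of_mem haS]; omega
        have haS₀ : a ∉ S₀ := Finset.notMem_erase a S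
        rw [← Finset.insert_erase haS, Finset.coe_insert,
          linearIndepOn_insert (fun h => haS₀ (Finset.mem_coe.mp h))]
        refine ⟨(hli S₀ hS₀T hS₀k.le).congr (heqOn S₀ haS₀), ?_⟩
        rw [Function.update_self]
        have himg : Function.update u' a z '' (S₀ : Set X) = u' '' (S₀ : Set X) :=
          (Set.EqOn.image_eq (heqOn S₀ haS₀)).symm
        rw [himg, ← Finset.coe_image]
        exact hzW ⟨S₀, hS₀T, hS₀k⟩
      · -- `S ⊆ T`
        have hST : S ⊆ T := fun x hx => (Finset.mem_insert.mp (hS hx)).resolve_left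
          (fun hxa => haS (hxa ▸ hx))
        exact (hli S hST hSk).congr (heqOn S haS)

end Summit.QuantumAdvantage.QuantumAdvantage.Theorems.HankelLift.Forster
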